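/-
Copyright (c) 2026 the pub-hodgecm-mathlib formalisation cell (harness21).  Prover seat hodgecm-mathlib-K2E1-p13 (g3) (R90-TF section S8 «ContSpec-n½», planner R90-CS-plan (g0),
word 15:57:33Z «the S one first»): the TORUS ∕ HILBERT-90 STEP of the road `R90/S8/ROAD-S8B2.K2E1-p13-g3.md` (R5) — a cuspidal datum `χ` of the Borel of `U(J₂)` with `χ|_{𝕀_F} = 1` is the
restriction of a GLOBAL determinant character `ψ ∘ det`, so its sections are det-twists of sections of the trivial datum.
-/
import Summits.HodgeConjecture.HodgeConjecture.Theorems.K2E1CharacterEisensteinU2Defs       -- ★ `IsChiSection`, `firstEntryUnit` (DEFS of the χ-road)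
import Summits.HodgeConjecture.HodgeConjecture.Theorems.K2E1ChiSectionSpaceU2Defs           -- ★ `firstEntryUnit_eq_diagUnit_zero`
import Literature.NumberTheory.Automorphic.UnitaryGroupDetCharacter                        -- ★ `detChar`, `detChar_apply`, `cmDetChar`, `coe_adelicDet`
import Literature.NumberTheory.Automorphic.UnitaryGroupAdelicOneTorusDictionary            -- ★ `adelicOneEquivTorus` (identity on ideles)
import Literature.NumberTheory.Automorphic.Arthur2013.Leaves.TorusDictionary               -- ★ `TorusDict.pullback`, `exists_pullback_eq` (idelic Hilbert 90), `pullback_ideleBaseChange`, `twistToTorus`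
import Literature.NumberTheory.Automorphic.UnitaryGroupTorusSiegelSetTwo                   -- ★ `diagUnit_one_two` (`d₁ = (c•d₀)⁻¹`)
import Literature.NumberTheory.Automorphic.UnitaryGroupTorusRayTwo                         -- ★ `adelicVal_torus_eq_glDiagonal_diagUnit_two`
import Literature.NumberTheory.Automorphic.UnitaryGroupGenericity                          -- ★ `mem_adelicUnipotent_iff`
import Literature.NumberTheory.Automorphic.MahlerCriterionPrelims                          -- ★ `Mahler.det_eq_one_of_mem_upperUnitriangular`
import HarnessLib

/-!
# K2·E1 ∕ R90·S8 — `K2E1ChiDetCharTorusDescentU2`: ON THE BOREL OF `U(J₂)`, `ψ ∘ det = (χ̃_ψ)⁻¹ ∘ b₀₀` (`χ̃_ψ` THE DICTIONARY CHARACTER `z ↦ ψ(z̄∕z)`), AND CONVERSELY A HECKE CHARACTER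
# `χ` OF `E` TRIVIAL ON `𝕀_F` IS `(ψ ∘ det)|_B` FOR AN AUTOMORPHIC `ψ` OF `U(1)` (idelic Hilbert 90) — so `χ`-sections are det-TWISTS of sections of the trivial datum

Cell `pub/hodgecm-mathlib`, crux h413 = `stmt-HodgeConjecture-24833`, route of record `HCCMUnconditional`; R90-TF section S8, socket S8B#4 road (R5 «residue identification»: with
K2E1-p10's det-TWIST file `E(Θ·f) = Θ·E(f)` this reduces the residues of the `χ`-family with `χ₀ = 1` to the ★ trivial-datum residues = constants, times `Θ = ψ∘det`).
THEOREMS ONLY (no `def`, no `instance`, no notation, no named-fact hypothesis, no `sorry`; default heartbeats); lane `--supports stmt-HodgeConjecture-24833 --as helper` (count-neutral).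

THE MATHEMATICS ([Rogawski1990, §13.9 (i) p. 229, §13.3 p. 202]; [GelbartRogawski1991, §3.1 Remark p. 457]; [CasselsFrohlichANT1967, Ch. VII (Tate) §7.4]).  In `U(J₂)` the diagonal
torus is `t = diag(d₀, (c d₀)⁻¹)` (★ `adelicVal_torus_eq_glDiagonal_diagUnit_two`, ★ `diagUnit_one_two`), so `det t = d₀∕(c d₀)` (§1) and for an automorphic character `ψ` of
`U(1)(𝔸_F) = T¹` the determinant character (★ `detChar`) restricts to the torus as `ψ(d₀∕\bar d₀) = (χ̃_ψ(d₀))⁻¹`, `χ̃_ψ = ` ★ `TorusDict.pullback ψ` (`z ↦ ψ(c•z∕z)`); the same on the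
whole Borel since `det` kills the unipotent radical (§1, ★ `Mahler.det_eq_one_of_mem_upperUnitriangular`).  Conversely (§2) a Hecke character `χ` of `E` trivial on `𝕀_F` is
`χ̃_ψ⁻¹`… precisely `χ⁻¹ = χ̃_ψ` for a unique automorphic `ψ` (★ `TorusDict.exists_pullback_eq`, idelic Hilbert 90), whence `χ(b₀₀) = (ψ∘det)(b)` on `B(𝔸_F)`.  §3: twisting a `χ₁`-section
by a multiplicative `Θ : G(𝔸) → ℂˣ` with `Θ|_B = η ∘ b₀₀` gives an `(η·χ₁)`-section (★ `IsChiSection`); with `Θ = ψ∘det`: every `χ`-section, `χ₀ = 1`, is `Θ ·` (a section of the trivial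
datum) and vice versa.  §4 the CM prints (`cmDetChar`).
HONEST LABEL: HC_CM is proved only modulo the 7 printed citations (2 remaining named inputs: hLiu418 = `stmt-HodgeConjecture-24832`, h413 = `stmt-HodgeConjecture-24833`) until rung 0
closes; REL ≠ ★ ≠ BUILT; count-neutral helper; closes no socket.

## References
* [Rogawski1990] J. D. Rogawski, *Automorphic Representations of Unitary Groups in Three Variables* (1990): §13.9 (i) p. 229, §13.3 p. 202 (`χ∘det`), §1.10.
* [GelbartRogawski1991] S. Gelbart, J. Rogawski, *L-functions and Fourier–Jacobi coefficients for the unitary group U(3)*, Invent. Math. 105 (1991): §3.1 Remark p. 457.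
* [CasselsFrohlichANT1967] J. Tate, *Global class field theory*, in Cassels–Fröhlich (1967): Ch. VII §7.4 (Hilbert 90 for ideles).
-/

set_option autoImplicit false
set_option linter.dupNamespace false  -- the mandated namespace repeats the summit's segment (`HodgeConjecture.HodgeConjecture`)

noncomputable section

open NumberField IsDedekindDomain
open Literature.NumberTheory.Automorphic Literature.NumberTheory.Automorphic.UnitaryGroup Literature.NumberTheory.GaloisRepresentations
open Literature.NumberTheory.Automorphic.Arthur2013.Leaves.TECR
open Summit.HodgeConjecture.HodgeConjecture.Cruxes.H413.K2E1CharacterEisensteinU2Defs (IsChiSection firstEntryUnit)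
open Summit.HodgeConjecture.HodgeConjecture.Cruxes.H413.K2E1ChiSectionSpaceU2Defs (firstEntryUnit_eq_diagUnit_zero)

namespace Summit.HodgeConjecture.HodgeConjecture.Cruxes.H413.K2E1ChiDetCharTorusDescentU2

section Quadratic

variable {F E : Type} [Field F] [NumberField F] [Field E] [NumberField E] [Algebra F E] {c : E ≃ₐ[F] E}
  (h2 : Module.finrank F E = 2) (hc : c ≠ 1) (hJ : ((StdForm.antidiagonal 2).over E).det ≠ 0)

/-! ## §1 `det` on the Borel of `U(J₂)`: `det t = d₀∕(c d₀)`, `det u = 1`, and `ψ∘det = (χ̃_ψ)⁻¹ ∘ b₀₀` -/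

/-- **`det diag(d₀, (c d₀)⁻¹) = d₀ · (c•d₀)⁻¹`** as an idele (★ `adelicVal_torus_eq_glDiagonal_diagUnit_two`, ★ `diagUnit_one_two`). [cite: Rogawski1990, §1.10] -/
theorem coe_adelicDet_torus_two (t : torusInBorel F E c 2) :
    ((adelicDet F E c 2 ((StdForm.antidiagonal 2).over E) hJ ((t : borelAdelic F E c 2) : (quasiSplit F E c 2).Adelic) : adelicOne F E c) : ideleGroup E) =
      diagUnit (t : borelAdelic F E c 2).2 0 * (c • diagUnit (t : borelAdelic F E c 2).2 0)⁻¹ := by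
  have ht : torusPart (t : borelAdelic F E c 2) = t := (mem_torusInBorel_iff_torusPart_eq _).1 t.2
  rw [coe_adelicDet, ← adelicVal_apply, adelicVal_torus_eq_glDiagonal_diagUnit_two, ← diagUnit_one_two ht]
  refine Units.ext ?_
  rw [Matrix.GeneralLinearGroup.val_det_apply, coe_glDiagonal, Matrix.det_diagonal, Fin.prod_univ_two, Units.val_mul]

/-- In the torus `T(𝔸_F)`: `det t = (c•d₀∕d₀)⁻¹ = (twistToTorus d₀)⁻¹` (★ `adelicOneEquivTorus` is the identity on ideles). [cite: CasselsFrohlichANT1967, Ch. VII §7.4] -/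
theorem adelicOneEquivTorus_adelicDet_torus_two (t : torusInBorel F E c 2) :
    adelicOneEquivTorus F E c (adelicDet F E c 2 ((StdForm.antidiagonal 2).over E) hJ ((t : borelAdelic F E c 2) : (quasiSplit F E c 2).Adelic)) =
      (TorusDict.twistToTorus c h2 hc (diagUnit (t : borelAdelic F E c 2).2 0))⁻¹ := by
  refine Subtype.ext ?_
  rw [coe_adelicOneEquivTorus, coe_adelicDet_torus_two hJ t, Subgroup.coe_inv, TorusDict.coe_twistToTorus_apply, Herbrand.twist_apply, inv_div, div_eq_mul_inv]

/-- **`(ψ∘det)(t) = χ̃_ψ(d₀ t)⁻¹` ON THE TORUS**: the determinant character of an automorphic `ψ` of `U(1)(𝔸_F)` restricts to `T(𝔸_F) ≅ 𝕀_E` as the INVERSE of the dictionary character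
`χ̃_ψ = TorusDict.pullback ψ` (`z ↦ ψ(c•z∕z)`), i.e. as `d ↦ ψ(d∕d̄)`. [cite: GelbartRogawski1991, §3.1 Remark p. 457] [cite: Rogawski1990, §13.3 p. 202] -/
theorem detChar_torus_two (ψ : ↥(TorusDict.torus c) →ₜ* ℂˣ) (hψ : TorusDict.IsAutomorphic c ψ) (t : torusInBorel F E c 2) :
    detChar F E c h2 hc 2 ((StdForm.antidiagonal 2).over E) ψ hψ hJ ((t : borelAdelic F E c 2) : (quasiSplit F E c 2).Adelic) =
      (TorusDict.pullback c h2 hc ψ hψ)⁻¹ (diagUnit (t : borelAdelic F E c 2).2 0) := by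
  rw [detChar_apply, adelicOneEquivTorus_adelicDet_torus_two h2 hc hJ t, map_inv, HeckeCharacter.inv_apply, TorusDict.pullback_apply]

/-- `det u = 1` on the unipotent radical `N(𝔸_F)` of `U(J₂)` (upper unitriangular, ★ `Mahler.det_eq_one_of_mem_upperUnitriangular`). [cite: Rogawski1990, §1.10] -/
theorem adelicDet_eq_one_of_mem_adelicUnipotent {N : ℕ} [NeZero N] (hJN : ((StdForm.antidiagonal N).over E).det ≠ 0)
    {u : (quasiSplit F E c N).Adelic} (hu : u ∈ adelicUnipotent F E c N) :
    adelicDet F E c N ((StdForm.antidiagonal N).over E) hJN u = 1 := by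
  refine Subtype.ext ?_
  rw [coe_adelicDet, OneMemClass.coe_one]
  exact Mahler.det_eq_one_of_mem_upperUnitriangular ((mem_adelicUnipotent_iff u).1 hu)

/-- The torus part keeps the diagonal: `d₀(torusPart b) = b₀₀`. [cite: Rogawski1990, §1.10] -/
theorem diagUnit_torusPart_zero {N : ℕ} [NeZero N] (b : borelAdelic F E c N) : diagUnit (torusPart b).2 0 = diagUnit b.2 0 := by
  refine Units.ext ?_
  rw [coe_diagUnit, adelicVal_torusPart, coe_glDiagonal, Matrix.diagonal_apply_eq, coe_diagUnit]

/-- **`(ψ∘det)(b) = χ̃_ψ(b₀₀)⁻¹` ON THE WHOLE BOREL `B(𝔸_F)` of `U(J₂)`** (`b = torusPart b · u`, `det u = 1`, ★ `firstEntryUnit = d₀`). [cite: GelbartRogawski1991, §3.1 Remark p. 457]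
[cite: Rogawski1990, §13.3 p. 202] -/
theorem detChar_borel_two (ψ : ↥(TorusDict.torus c) →ₜ* ℂˣ) (hψ : TorusDict.IsAutomorphic c ψ) (b : borelAdelic F E c 2) :
    detChar F E c h2 hc 2 ((StdForm.antidiagonal 2).over E) ψ hψ hJ (b : (quasiSplit F E c 2).Adelic) = (TorusDict.pullback c h2 hc ψ hψ)⁻¹ (firstEntryUnit b.2) := by
  have hsplit : (b : (quasiSplit F E c 2).Adelic) = ((torusPart b : borelAdelic F E c 2) : (quasiSplit F E c 2).Adelic) * (((torusPart b)⁻¹ * b : borelAdelic F E c 2) : (quasiSplit F E c 2).Adelic) := by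
    rw [Subgroup.coe_mul, Subgroup.coe_inv, mul_inv_cancel_left]
  have hu : adelicDet F E c 2 ((StdForm.antidiagonal 2).over E) hJ (((torusPart b)⁻¹ * b : borelAdelic F E c 2) : (quasiSplit F E c 2).Adelic) = 1 :=
    adelicDet_eq_one_of_mem_adelicUnipotent hJ (torusPart_inv_mul_mem_adelicUnipotent b)
  have hT : ((torusPart b : borelAdelic F E c 2) : (quasiSplit F E c 2).Adelic) ∈ torusAdelic F E c 2 := torusPart_mem_torusAdelic b
  -- `(ψ∘det)(b) = (ψ∘det)(torusPart b)`
  have h1 : detChar F E c h2 hc 2 ((StdForm.antidiagonal 2).over E) ψ hψ hJ (b : (quasiSplit F E c 2).Adelic) =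
      detChar F E c h2 hc 2 ((StdForm.antidiagonal 2).over E) ψ hψ hJ ((torusPart b : borelAdelic F E c 2) : (quasiSplit F E c 2).Adelic) := by
    have hm := map_mul (detChar F E c h2 hc 2 ((StdForm.antidiagonal 2).over E) ψ hψ hJ) ((torusPart b : borelAdelic F E c 2) : (quasiSplit F E c 2).Adelic)
      (((torusPart b)⁻¹ * b : borelAdelic F E c 2) : (quasiSplit F E c 2).Adelic)
    rw [← hsplit, detChar_apply F E c h2 hc 2 _ ψ hψ hJ (((torusPart b)⁻¹ * b : borelAdelic F E c 2) : (quasiSplit F E c 2).Adelic), hu, map_one, map_one, mul_one] at hm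
    exact hm
  have h2' := detChar_torus_two h2 hc hJ ψ hψ ⟨torusPart b, hT⟩
  rw [h1, firstEntryUnit_eq_diagUnit_zero, ← diagUnit_torusPart_zero b]
  exact h2'

/-! ## §2 Descent (idelic Hilbert 90): `χ` trivial on `𝕀_F` is `(ψ∘det)|_B` -/

/-- `(χ̃_ψ)⁻¹` is trivial on `𝕀_F ↪ 𝕀_E` (★ `pullback_ideleBaseChange`). [cite: CasselsFrohlichANT1967, Ch. VII §7.4] -/
theorem pullback_inv_ideleBaseChange (ψ : ↥(TorusDict.torus c) →ₜ* ℂˣ) (hψ : TorusDict.IsAutomorphic c ψ) (a : ideleGroup F) :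
    (TorusDict.pullback c h2 hc ψ hψ)⁻¹ (AdeleRing.ideleBaseChange F E a) = 1 := by
  rw [HeckeCharacter.inv_apply, TorusDict.pullback_ideleBaseChange, inv_one]

/-- **DESCENT — A HECKE CHARACTER OF `E` TRIVIAL ON `𝕀_F` IS THE BOREL RESTRICTION OF A GLOBAL DETERMINANT CHARACTER `ψ∘det` OF `U(J₂)(𝔸_F)`**: `χ = (χ̃_ψ)⁻¹` for an automorphic `ψ` of
`U(1)(𝔸_F)` (★ `TorusDict.exists_pullback_eq` applied to `χ⁻¹`), hence `χ(b₀₀) = (ψ∘det)(b)` for every `b ∈ B(𝔸_F)` (§1).  This is the group theory of case (i) of [Rogawski1990, §13.9]: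
the cuspidal data of the Borel whose Eisenstein series have a residue (`χ₀ = 1`, ★ `K2E1ChiIntertwiningScalarEulerQuotientU2`) are exactly the restrictions of the global characters `ψ∘det`.
[cite: CasselsFrohlichANT1967, Ch. VII §7.4] [cite: Rogawski1990, §13.9 (i) p. 229] -/
theorem exists_detChar_borel_eq_two (χ : HeckeCharacter E) (hχ : ∀ a : ideleGroup F, χ (AdeleRing.ideleBaseChange F E a) = 1) :
    ∃ (ψ : ↥(TorusDict.torus c) →ₜ* ℂˣ) (hψ : TorusDict.IsAutomorphic c ψ), (TorusDict.pullback c h2 hc ψ hψ)⁻¹ = χ ∧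
      ∀ b : borelAdelic F E c 2, detChar F E c h2 hc 2 ((StdForm.antidiagonal 2).over E) ψ hψ hJ (b : (quasiSplit F E c 2).Adelic) = χ (firstEntryUnit b.2) := by
  obtain ⟨ψ, hψ, h⟩ := TorusDict.exists_pullback_eq c h2 hc χ⁻¹ fun a => by rw [HeckeCharacter.inv_apply, hχ, inv_one]
  have hinv : (TorusDict.pullback c h2 hc ψ hψ)⁻¹ = χ := by rw [h, inv_inv]
  exact ⟨ψ, hψ, hinv, fun b => by rw [detChar_borel_two h2 hc hJ ψ hψ b, hinv]⟩

/-! ## §3 Sections: twisting by `Θ = ψ∘det` -/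

/-- **TWISTING A `χ₁`-SECTION BY A MULTIPLICATIVE `Θ : G(𝔸) → ℂˣ` WITH `Θ|_B = η ∘ b₀₀` GIVES AN `(η·χ₁)`-SECTION** (`(Θφ)(bg) = Θ(b)Θ(g)χ₁(b₀₀)φ(g)`). [cite: MoeglinWaldspurger1995, I.2.17] -/
theorem isChiSection_mul_of_borel {N : ℕ} [NeZero N] (Θ : (quasiSplit F E c N).Adelic → ℂˣ) (hΘ : ∀ g h, Θ (g * h) = Θ g * Θ h) (η : HeckeCharacter E)
    (hΘη : ∀ b : borelAdelic F E c N, Θ (b : (quasiSplit F E c N).Adelic) = η (firstEntryUnit b.2)) {χ₁ : HeckeCharacter E} {φ : (quasiSplit F E c N).Adelic → ℂ}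
    (hφ : IsChiSection χ₁ φ) : IsChiSection (η * χ₁) (fun g => ((Θ g : ℂˣ) : ℂ) * φ g) := by
  intro b hb g
  show ((Θ (b * g) : ℂˣ) : ℂ) * φ (b * g) = (((η * χ₁) (firstEntryUnit hb) : ℂˣ) : ℂ) * (((Θ g : ℂˣ) : ℂ) * φ g)
  rw [hΘ, hφ b hb g, hΘη ⟨b, hb⟩, HeckeCharacter.mul_apply, Units.val_mul, Units.val_mul]
  ring

/-- **`χ₀ = 1`: EVERY `χ`-SECTION IS A det-TWIST OF A SECTION OF THE TRIVIAL DATUM** — for `χ = (χ̃_ψ)⁻¹` and `Θ = ψ∘det` (★ `detChar`): `IsChiSection 1 φ₁ → IsChiSection χ (Θ·φ₁)`.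
[cite: Rogawski1990, §13.9 (i) p. 229] [cite: MoeglinWaldspurger1995, I.2.17] -/
theorem isChiSection_detChar_mul (ψ : ↥(TorusDict.torus c) →ₜ* ℂˣ) (hψ : TorusDict.IsAutomorphic c ψ) {φ₁ : (quasiSplit F E c 2).Adelic → ℂ} (hφ₁ : IsChiSection 1 φ₁) :
    IsChiSection (TorusDict.pullback c h2 hc ψ hψ)⁻¹
      (fun g => ((detChar F E c h2 hc 2 ((StdForm.antidiagonal 2).over E) ψ hψ hJ g : ℂˣ) : ℂ) * φ₁ g) := by
  have h := isChiSection_mul_of_borel (N := 2) (⇑(detChar F E c h2 hc 2 ((StdForm.antidiagonal 2).over E) ψ hψ hJ))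
    (fun g h => map_mul (detChar F E c h2 hc 2 ((StdForm.antidiagonal 2).over E) ψ hψ hJ) g h)
    (TorusDict.pullback c h2 hc ψ hψ)⁻¹ (fun b => detChar_borel_two h2 hc hJ ψ hψ b) hφ₁
  rwa [mul_one] at h

/-- **… AND CONVERSELY**: `IsChiSection χ φ → IsChiSection 1 (Θ⁻¹·φ)` for `χ = (χ̃_ψ)⁻¹`, `Θ = ψ∘det`. [cite: Rogawski1990, §13.9 (i) p. 229] [cite: MoeglinWaldspurger1995, I.2.17] -/
theorem isChiSection_one_detChar_inv_mul (ψ : ↥(TorusDict.torus c) →ₜ* ℂˣ) (hψ : TorusDict.IsAutomorphic c ψ) {φ : (quasiSplit F E c 2).Adelic → ℂ}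
    (hφ : IsChiSection (TorusDict.pullback c h2 hc ψ hψ)⁻¹ φ) :
    IsChiSection 1 (fun g => (((detChar F E c h2 hc 2 ((StdForm.antidiagonal 2).over E) ψ hψ hJ g)⁻¹ : ℂˣ) : ℂ) * φ g) := by
  have h := isChiSection_mul_of_borel (N := 2) (fun g => (detChar F E c h2 hc 2 ((StdForm.antidiagonal 2).over E) ψ hψ hJ g)⁻¹)
    (fun g h => by simp only [map_mul, mul_inv])
    (TorusDict.pullback c h2 hc ψ hψ) (fun b => by simp only [detChar_borel_two h2 hc hJ ψ hψ b, HeckeCharacter.inv_apply, inv_inv]) hφ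
  rwa [mul_inv_cancel] at h

end Quadratic

/-! ## §4 The CM prints (`U(1,1)_{L∕L⁺}`, `cmDetChar`) -/

section CM

variable (L : Type) [Field L] [NumberField L] [IsCMField L]

/-- **CM: `(ψ∘det)(b) = χ̃_ψ(b₀₀)⁻¹` on the Borel of `U(Φ₂)_{L∕L⁺}`** (★ `cmDetChar` = `detChar` at the CM pair). [cite: GelbartRogawski1991, §3.1 Remark p. 457] -/
theorem cmDetChar_borel_two (ψ : ↥(TorusDict.torus (IsCMField.complexConj L)) →ₜ* ℂˣ) (hψ : TorusDict.IsAutomorphic (IsCMField.complexConj L) ψ)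
    (b : borelAdelic (↥(maximalRealSubfield L)) L (IsCMField.complexConj L) 2) :
    cmDetChar L 2 ((StdForm.antidiagonal 2).over L) ψ hψ ((Matrix.isUnit_iff_isUnit_det _).mp (StdForm.isUnit_over (StdForm.antidiagonal 2) L)).ne_zero (b : (quasiSplit (↥(maximalRealSubfield L)) L (IsCMField.complexConj L) 2).Adelic) =
      (TorusDict.pullback (IsCMField.complexConj L) (Algebra.IsQuadraticExtension.finrank_eq_two _ L) (IsCMField.complexConj_ne_one L) ψ hψ)⁻¹ (firstEntryUnit b.2) :=
  detChar_borel_two _ _ _ ψ hψ b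

/-- **CM DESCENT: a Hecke character `χ` of `L` trivial on `𝕀_{L⁺}` is the Borel restriction of a global `ψ∘det` of `U(Φ₂)(𝔸_{L⁺})`, `ψ` automorphic on `U(1)_{L∕L⁺}(𝔸)`.**
[cite: CasselsFrohlichANT1967, Ch. VII §7.4] [cite: Rogawski1990, §13.9 (i) p. 229] -/
theorem cm_exists_cmDetChar_borel_eq_two (χ : HeckeCharacter L) (hχ : ∀ a : ideleGroup ↥(maximalRealSubfield L), χ (AdeleRing.ideleBaseChange ↥(maximalRealSubfield L) L a) = 1) :
    ∃ (ψ : ↥(TorusDict.torus (IsCMField.complexConj L)) →ₜ* ℂˣ) (hψ : TorusDict.IsAutomorphic (IsCMField.complexConj L) ψ),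
      (TorusDict.pullback (IsCMField.complexConj L) (Algebra.IsQuadraticExtension.finrank_eq_two _ L) (IsCMField.complexConj_ne_one L) ψ hψ)⁻¹ = χ ∧
      ∀ b : borelAdelic (↥(maximalRealSubfield L)) L (IsCMField.complexConj L) 2,
        cmDetChar L 2 ((StdForm.antidiagonal 2).over L) ψ hψ ((Matrix.isUnit_iff_isUnit_det _).mp (StdForm.isUnit_over (StdForm.antidiagonal 2) L)).ne_zero (b : (quasiSplit (↥(maximalRealSubfield L)) L (IsCMField.complexConj L) 2).Adelic) =
          χ (firstEntryUnit b.2) :=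
  exists_detChar_borel_eq_two _ _ _ χ hχ

end CM

end Summit.HodgeConjecture.HodgeConjecture.Cruxes.H413.K2E1ChiDetCharTorusDescentU2

end
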